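import Literature.Probability.Distributions.GaussianSlabs

/-!
# NE9CutoffShell — NE9-CUT, the cut-off channel of the last-coupling modulus: why it is LIPSCHITZ in the threshold
displacement `ε₁|g⁻¹ − g′⁻¹|` (product small-field cut-offs at two couplings differ on one-bond shells; a centred Gaussian
bond variable gives a shell of width `w` mass `≤ 2w/√(2πv)`) — the mechanism behind the displayed (SHELL) binder of the
sibling leaf `NE9CouplingTwoPoint` (cell `pub-balaban`, T4-DAG §2 node U3 / §6 NE9; lineage t4-ne9-p1, generation 18)

HONEST FRAMING (T4-DAG PAGE 1).  Rung (B)+1 on a FIXED finite torus with `FlowStep.BetaPertH` and (B) explicit — NOT infinite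
volume, NOT a mass gap, NOT the Clay problem.  NE9 is a cell NEW ESTIMATE, NOT PRINTED.  This module is one-dimensional
measure theory and set algebra over ABSTRACT bond variables `B b : Ω → ℝ`; it asserts nothing about Bałaban's objects.  The
manuscripts [I] = [Balaban1987RG1], [II] = [Balaban1988RG2Cluster] are quoted for the TYPE of the cut-off only.

WHY.  In [II] the small-field cut-off of the step is carried by the varied coupling: «χ_k = Π χ({|B′(b)| < ε₁})» ([I] (2.9)
p. 266, read in the final variables as `|B(b)| < ε₁g_k^{−1}`, [II] (1.34) p. 9), decomposed over large-field bond sets by (2.3)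
p. 12.  The two-point bound of `NE9CouplingTwoPoint.norm_formAct_sub_formAct_le` in the last coupling therefore has, besides
the table channel (Cauchy in the dilated coupling) and the exponential channel, a CUT-OFF channel: the majorant integrated
over the symmetric difference `S(s) Δ S(s′)` of the cut-off sets at the two couplings — the step where the printed template
[Dimock2013] Lemma 22 has no counterpart (there the cut-off-carrying coupling is held fixed: «We continue to treat λ_k as a
parameter, not a dynamical variable», opening of Section 5).  For node U3 the
channel must be LINEAR in the threshold displacement (an `O(e^{−ε₁²/2g²v})` size bound of large-field type would not vanish
as ε → 0 at the last scales); this leaf isolates why it is: (§1) `S(s) Δ S(s′)` lies in a union of ONE-BOND SHELLS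
`ε₁/max(s,s′) ≤ |B(b)| < ε₁/min(s,s′)`, of width exactly `ε₁|s⁻¹ − s′⁻¹|` — a bounded modulus in `t = g⁻²`
(§3 `inv_sub_inv_le`: `|s⁻¹ − s′⁻¹| ≤ (γ/2)|s⁻² − s′⁻²|` on `]0, γ]`); (§2) a centred Gaussian bond variable of variance `v` gives any shell `a ≤ |x| < a′`
mass `≤ 2(a′ − a)/√(2πv)` (density ≤ peak, tree `gaussianPDFReal_le_peak`).  What stays DISPLAYED in the sibling leaf is the
SLICE MAJORANT: the Lemma-3 chain (2.15)→(2.26)→(2.38) of [II] with one fluctuation variable pinned in the shell, of which §2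
is the case «prefactor ≡ 1, exponent ≡ 0, one variable» (the pinned Gaussian factor at `|x| ≈ ε₁/g` is moreover the
large-field smallness `e^{−(ε₁/g)²/2v}` of (2.31) p. 18 — not used).  NOT summit progress; 0/9 unchanged.

References (TYPES only): [Balaban1987RG1] CMP 109 (1987) (2.9) p. 266; [Balaban1988RG2Cluster] CMP 116 (1988) (1.34) p. 9,
(2.3) p. 12, (2.31) p. 18; [Dimock2013] J. Dimock, Rev. Math. Phys. 25 (2013) 1330010, Lemma 22.
v1.0.1 (DOCFIX, docstring-only; every declaration byte-identical to v1 p201207): the [Dimock2013] sentence quoted verbatim.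
-/

noncomputable section

namespace Summit.QuantumFields.BalabanUV.T4Continuum.NE9CutoffShell

open MeasureTheory Set
open scoped NNReal ENNReal symmDiff

/-! ## §1 Product cut-offs at two couplings differ on one-bond shells -/

section Shell

variable {Ω : Type*} {Bd : Type*}

/-- The PRODUCT small-field cut-off at coupling `s` over a finite bond set: «χ_k = Π_b χ({|B′(b)| < ε₁})» of [I] (2.9)
p. 266 read in the final variables, «{B : |B| < ε₁g_k^{−1} on Y}» of [II] (1.34) p. 9: the set of samples whose bond variables
`B b` are all below the threshold `ε₁/s`. [cite: Balaban1988RG2Cluster, (1.34) p.9; Balaban1987RG1, (2.9) p.266] -/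
def prodCutoff (bonds : Finset Bd) (B : Bd → Ω → ℝ) (ε₁ s : ℝ) : Set Ω :=
  {ω | ∀ b ∈ bonds, |B b ω| < ε₁ / s}

/-- The one-bond SHELL between the thresholds of two couplings: `ε₁/max(s, s′) ≤ |B b ω| < ε₁/min(s, s′)`. [folklore] -/
def bondShell (B : Bd → Ω → ℝ) (ε₁ s s' : ℝ) (b : Bd) : Set Ω :=
  {ω | ε₁ / max s s' ≤ |B b ω| ∧ |B b ω| < ε₁ / min s s'}

/-- **The two cut-off sets differ only on one-bond shells**: `S(s) Δ S(s′) ⊆ ⋃_{b ∈ bonds} shell_b(s, s′)` (for `ε₁ ≥ 0`,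
`s, s′ > 0`).  This is why the cut-off channel of the two-point bound is an integral over a union of thin shells, one per
cut-off bond of the polymer ([II] p. 12: the bonds of `T₁^{(k)}` in `Y₀` other than the `b₀(c)`, `c ∈ T^{(k+1)}` — at most
`4L⁴ − 1` per `L`-cube in four dimensions). [folklore] -/
theorem prodCutoff_symmDiff_subset (bonds : Finset Bd) (B : Bd → Ω → ℝ) {ε₁ s s' : ℝ} (hε : 0 ≤ ε₁) (hs : 0 < s)
    (hs' : 0 < s') :
    prodCutoff bonds B ε₁ s ∆ prodCutoff bonds B ε₁ s' ⊆ ⋃ b ∈ bonds, bondShell B ε₁ s s' b := by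
  intro ω hω
  simp only [Set.mem_iUnion, bondShell, Set.mem_setOf_eq, exists_prop]
  -- without loss of generality by symmetry of the statement in (s, s')
  have key : ∀ {u u' : ℝ}, 0 < u → 0 < u' → ω ∈ prodCutoff bonds B ε₁ u → ω ∉ prodCutoff bonds B ε₁ u' →
      ∃ b ∈ bonds, ε₁ / max u u' ≤ |B b ω| ∧ |B b ω| < ε₁ / min u u' := by
    intro u u' hu hu' hin hout
    simp only [prodCutoff, Set.mem_setOf_eq, not_forall, not_lt, exists_prop] at hin hout
    obtain ⟨b, hb, hge⟩ := hout
    refine ⟨b, hb, ?_, ?_⟩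
    · exact le_trans (div_le_div_of_nonneg_left hε hu' (le_max_right u u')) hge
    · exact lt_of_lt_of_le (hin b hb) (div_le_div_of_nonneg_left hε (lt_min hu hu') (min_le_left u u'))
  rcases (Set.mem_symmDiff.1 hω) with ⟨hin, hout⟩ | ⟨hin, hout⟩
  · exact key hs hs' hin hout
  · obtain ⟨b, hb, h1, h2⟩ := key hs' hs hin hout
    exact ⟨b, hb, by rwa [max_comm], by rwa [min_comm]⟩

/-- The shell WIDTH is the threshold displacement: `ε₁/min(s, s′) − ε₁/max(s, s′) = ε₁·|s⁻¹ − s′⁻¹|` (`s, s′ > 0`). [folklore] -/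
theorem shellWidth_eq {ε₁ s s' : ℝ} (hs : 0 < s) (hs' : 0 < s') :
    ε₁ / min s s' - ε₁ / max s s' = ε₁ * |s⁻¹ - s'⁻¹| := by
  rcases le_total s s' with h | h
  · rw [min_eq_left h, max_eq_right h, abs_of_nonneg (sub_nonneg.2 (inv_anti₀ hs h))]
    ring
  · rw [min_eq_right h, max_eq_left h, abs_of_nonpos (sub_nonpos.2 (inv_anti₀ hs' h))]
    ring

/-! ## §2 The Gaussian shell mass -/

/-- **The one-dimensional Gaussian gives a shell of width `w` mass at most `2w/√(2πv)`**: for `a ≤ a′`,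
`𝒩(0, v){x : a ≤ |x| < a′} ≤ 2(a′ − a)/√(2πv)` (density bounded by its peak, tree `gaussianPDFReal_le_peak`; the two
intervals `[−a′, −a]`, `[a, a′]`).  With §1's inclusion this is the MECHANISM behind the displayed (SHELL) binder of `NE9CouplingTwoPoint` §1/§3:
per bond, (bounded marginal density of the fluctuation variable) × (width `ε₁|s⁻¹ − s′⁻¹|`); what stays displayed is the
SLICE MAJORANT — the Lemma-3 chain (2.15)→(2.26)→(2.38) of [II] with one fluctuation variable pinned in the shell — of which
this lemma is the case `pre ≡ 1`, `ê ≡ 0`, one variable.  (The pinned Gaussian factor at `|x| ≈ ε₁/g` is moreover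
`≤ e^{−(ε₁/g)²/(2v)}`, the large-field smallness of (2.31) p. 18 — not used.) [folklore] -/
theorem gaussianReal_shell_le {v : ℝ≥0} (hv : v ≠ 0) {a a' : ℝ} (haa' : a ≤ a') :
    ProbabilityTheory.gaussianReal 0 v {x | a ≤ |x| ∧ |x| < a'} ≤
      ENNReal.ofReal (2 * (a' - a) * (Real.sqrt (2 * Real.pi * v))⁻¹) := by
  have hsub : {x : ℝ | a ≤ |x| ∧ |x| < a'} ⊆ Set.Icc (-a') (-a) ∪ Set.Icc a a' := by
    intro x hx
    simp only [Set.mem_setOf_eq] at hx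
    rcases le_or_gt 0 x with h | h
    · right; rw [abs_of_nonneg h] at hx; exact ⟨hx.1, hx.2.le⟩
    · left; rw [abs_of_neg h] at hx; constructor <;> linarith [hx.1, hx.2]
  have hpeak : ∀ (I : Set ℝ), ProbabilityTheory.gaussianReal 0 v I ≤
      ENNReal.ofReal ((Real.sqrt (2 * Real.pi * v))⁻¹) * volume I := fun I => by
    rw [ProbabilityTheory.gaussianReal_apply _ hv]
    calc ∫⁻ x in I, ProbabilityTheory.gaussianPDF 0 v x
        ≤ ∫⁻ _ in I, ENNReal.ofReal ((Real.sqrt (2 * Real.pi * v))⁻¹) :=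
          lintegral_mono fun x => ENNReal.ofReal_le_ofReal
            (Literature.Probability.Distributions.gaussianPDFReal_le_peak 0 v x)
      _ = ENNReal.ofReal ((Real.sqrt (2 * Real.pi * v))⁻¹) * volume I := setLIntegral_const _ _
  have hw : 0 ≤ a' - a := sub_nonneg.2 haa'
  calc ProbabilityTheory.gaussianReal 0 v {x | a ≤ |x| ∧ |x| < a'}
      ≤ ProbabilityTheory.gaussianReal 0 v (Set.Icc (-a') (-a) ∪ Set.Icc a a') := measure_mono hsub
    _ ≤ ProbabilityTheory.gaussianReal 0 v (Set.Icc (-a') (-a)) + ProbabilityTheory.gaussianReal 0 v (Set.Icc a a') :=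
        measure_union_le _ _
    _ ≤ ENNReal.ofReal ((Real.sqrt (2 * Real.pi * v))⁻¹) * volume (Set.Icc (-a') (-a)) +
          ENNReal.ofReal ((Real.sqrt (2 * Real.pi * v))⁻¹) * volume (Set.Icc a a') := add_le_add (hpeak _) (hpeak _)
    _ = ENNReal.ofReal (2 * (a' - a) * (Real.sqrt (2 * Real.pi * v))⁻¹) := by
        rw [Real.volume_Icc, Real.volume_Icc, show -a - -a' = a' - a by ring, ← mul_add,
          ← ENNReal.ofReal_add hw hw, ← ENNReal.ofReal_mul (by positivity), show a' - a + (a' - a) = 2 * (a' - a) by ring]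
        ring_nf

/-- The shell of §1 between the thresholds of two couplings, measured by a centred Gaussian bond variable: mass
`≤ 2ε₁|s⁻¹ − s′⁻¹|/√(2πv)` — LINEAR in the threshold displacement, hence (§3) a bounded modulus in `t = g⁻²`. [folklore] -/
theorem gaussianReal_thresholdShell_le {v : ℝ≥0} (hv : v ≠ 0) {ε₁ s s' : ℝ} (hε : 0 ≤ ε₁) (hs : 0 < s) (hs' : 0 < s') :
    ProbabilityTheory.gaussianReal 0 v {x | ε₁ / max s s' ≤ |x| ∧ |x| < ε₁ / min s s'} ≤
      ENNReal.ofReal (2 * (ε₁ * |s⁻¹ - s'⁻¹|) * (Real.sqrt (2 * Real.pi * v))⁻¹) := by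
  rw [← shellWidth_eq hs hs']
  exact gaussianReal_shell_le hv (div_le_div_of_nonneg_left hε (lt_min hs hs') min_le_max)

end Shell

/-! ## §3 The currency `t = g⁻²`: the shell width is a bounded t-modulus -/

/-- On the window `]0, γ]`: `|s⁻¹ − s′⁻¹| ≤ (γ/2)·|s⁻² − s′⁻²|` — the threshold displacement of the cut-off channel is a
BOUNDED modulus in `t = g⁻²` (the currency of the β-recursion `g_{k+1}^{−2} = g_k^{−2} + β_{k+1}` of node U2), like the table
channel's `|s − s′|/min(s, s′) ≤ (γ²/2)|s⁻² − s′⁻²|` (generation 17's `NE9FluctuationStep.inv_min_mul_abs_sub_le`). [folklore] -/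
theorem inv_sub_inv_le {s s' γ : ℝ} (hs : 0 < s) (hsγ : s ≤ γ) (hs' : 0 < s') (hs'γ : s' ≤ γ) :
    |s⁻¹ - s'⁻¹| ≤ γ / 2 * |(s ^ 2)⁻¹ - (s' ^ 2)⁻¹| := by
  have hss : 0 < s * s' := mul_pos hs hs'
  have e1 : s⁻¹ - s'⁻¹ = (s' - s) / (s * s') := by field_simp
  have e2 : (s ^ 2)⁻¹ - (s' ^ 2)⁻¹ = (s' - s) * (s' + s) / (s * s') ^ 2 := by
    field_simp
    ring
  have h1 : |s⁻¹ - s'⁻¹| = |s' - s| / (s * s') := by rw [e1, abs_div, abs_of_pos hss]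
  have h2 : |(s ^ 2)⁻¹ - (s' ^ 2)⁻¹| = |s' - s| * (s' + s) / (s * s') ^ 2 := by
    rw [e2, abs_div, abs_mul, abs_of_pos (by linarith : 0 < s' + s), abs_of_pos (pow_pos hss 2)]
  rw [h1, h2, div_le_iff₀ hss]
  have key : s * s' ≤ γ / 2 * (s' + s) := by nlinarith
  have hre : γ / 2 * (|s' - s| * (s' + s) / (s * s') ^ 2) * (s * s') = |s' - s| * (γ / 2 * (s' + s) / (s * s')) := by
    field_simp
  rw [hre]
  calc |s' - s| = |s' - s| * 1 := (mul_one _).symm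
    _ ≤ |s' - s| * (γ / 2 * (s' + s) / (s * s')) := by
        apply mul_le_mul_of_nonneg_left _ (abs_nonneg _)
        rw [le_div_iff₀ hss, one_mul]
        exact key

end Summit.QuantumFields.BalabanUV.T4Continuum.NE9CutoffShell

end
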